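import Literature.IUT.HodgeArakelov.BadPrimeGaussianMonoidsGenuineRecordAtModelTate
import Literature.IUT.HodgeArakelov.MonoThetaProjectiveNaturalSystemAtModelTate
import HarnessLib

/-!
# [IUTchII] Prop 3.1 (i) «splittings up to torsion» AT THE GENUINE `θ_env` RECORD OF THE TATE MODEL `modelTate p` — the instance
# of record: the record's own inputs (`h15`, `h15ii`, `hι`, `f`, `hZ`, `hlim`, `hp2`/`hpl`/`hζ`) DISCHARGED on top of
# `splitting_toRecord_padic_of_eval_modelχq` (proof-only; D-0079 K-L6)

S. Mochizuki, *Inter-universal Teichmüller theory II*, kurims manuscript (Dec. 2020), Prop. 3.1 (i) p. 87 («splittings up to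
torsion»), Cor. 2.8 (i) p. 82, Prop. 2.2 (ii) p. 66 [claim: Mochizuki2012, status: disputed] (IUTchII §3 Prop 3.1 (i), kurims p.87);
S. Mochizuki, *The étale theta function …* [EtTh], Publ. RIMS **45** (2009) (refereed): Prop. 1.5 (ii), (iii) p. 23, Thm. 1.6 (iii)
p. 24, Def. 2.7 p. 41, Cor. 2.19 (ii) p. 64 [cite: MochizukiEtTh2009, Thm 1.6 (iii) p.24].

Cell `abc-iut`, seat abc-iut-w5-d072 (gen 4; (R1) ι-datum custody lineage), D-0079 programme L-K, K-L6 slice, row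
«COR35ii-PROP31i-IOTA-DATUM-AT-MODELTATE» part 2/2 (abc-iut-L6-lead gen 6 §F v1.19be (1) GO; part 1/2 =
`BadPrimeGaussianMonoidsGenuineRecordAtModelTate.lean`, the stage-2 discharge of the ι-datum / class-level / `hker` binders over
ARBITRARY record inputs). PROOF-ONLY companion: NO definition, NO instance, NO new named fact; every input consumed BY NAME;
nothing landed is edited or restated. Data of record VERBATIM as in abc-iut-w5-d233's `MonoThetaProjectiveNaturalSystemAtModelTate`
(`nonempty_thetaEnvData_modelTate`) and abc-iut-w4-d038's `MonoThetaProjectiveBridgeEtThAtModelTate`: Galois factor `inr`, class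
`η̈♯ = etaDdχq`, `X̲̲ := Huuχq` via `doubleUnderlineχqOfEtaRes`, root cocycle `rootLift`, cyclotome family `τ.modAll` of a tower `τ`
(DATA; inhabited by abc-iut-L2-t8's `modelχq_nonempty_cyclotomeTower`), EMPTY cusp labelling, `l` an odd prime with `4l ∣ p − 1`.

THIS FILE: **`splitting_toRecord_padic_of_eval_modelTate`** — abc-iut-w4-d004's Prop 3.1 (i) closer of record
(`splitting_toRecord_padic_of_eval_pairRhoLim`, p441594) at that record, through part 1's `splitting_toRecord_padic_of_eval_modelχq`,
with IN ADDITION the record's own inputs theorems of the tree: `h15` (abc-iut-L2-t6 `prop15iii_etaleThetaDataOfClass_etaDdχq`, F-0591 at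
the instance), `h15ii` (abc-iut-L2-t8 `prop13_prop15_sectionData_modelTate`, F-2503 at the instance), `hι` (abc-iut-L2-d1
`map_Huuχq_inversionχq`), `hf` (abc-iut-w5-d233 `rootLift_mem_rootCocycles`), `hZ` (`ModelCyclotomes.nonempty_lDeltaQuot_rigidData_mulEquiv_zHat`
under abc-iut-L2-t5's `modelχq_isEtThOrigin` / `hYcl_modelχq`), `hlim` (abc-iut-w4-d030 `bijective_rigidLimHom`), `hp2`/`hpl`/`hζ`
(abc-iut-w5-d233, from `4l ∣ p − 1`). RESIDUAL OF RECORD for NODES IUTchII:Prop3.1(i) at the model of record (every binder after the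
`let`s): {(H1) `PiYddCharacteristic C` (FACT-LIST F-2633 AT THE INSTANCE; ROUTE A ⟸ F-0620 `Cor218_i` at the instance via abc-iut-w4-d013's
`piYddCharacteristic_of_cor218_i` — abc-iut-L6-d6's row «COR218I-AT-MODELTATE» decides it), the tower `τ` (DATA), and the [IUTchII]
Cor 3.5 (K)/(E) DATA: constants `c`/`c₀` on `ℚ̄_pˣ` bijective with `μ ⊆ O`, ONE evaluation section `s₀` with `hact` and finite-index
image, the evaluation `R₀ θ = κ₀ q` with `q` a non-unit, an inversion family `iota` through the limit action of `ι := inversionχq`, a base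
point `θ ∈ θ^{i₀}_env`} — NO ι-datum binder, NO class-level binder, NO `hker`, NO §1-fact binder.
APPENDIX (v2): `thetaEnv_toRecord_nonempty_modelχq` — the base-point binder is NOT vacuous: `θ^{i₀}_env(𝕄_*) ≠ ∅` at the
stage-2 model for the inversion family through `ι := inversionχq` and ANY `(act, κ)` (abc-iut-w4-d004's
`thetaEnv_toRecord_nonempty_pairRhoLim` with (R1) and (R2) `hsign`/`hroot` discharged at the model).

HONEST LABEL. `modelTate` is a SEMI-SYNTHETIC model of the typed [EtTh] §1 interface (`K = ℚ_p`, `q_X = p²`,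
`Π^tp_X = (F̂₂ ×_Ẑ ℤ) ⋊ G_{ℚ_p}`; not the tempered `π₁` of a curve, no theta FUNCTION): binder-discharge / joint-satisfiability evidence
for the typed interface only. The [IUTchII] claim key `Mochizuki2012` is DISPUTED (D-0012) and nothing of it is asserted; nothing of
[EtTh] is asserted; no side is taken on [IUTchIII] Cor. 3.12 nor on which lift of the inversion print's `ι` denotes; typed ≠ proved;
instantiated ≠ endorsed; nothing here bears on whether abc is proved or refuted. bears_on: LADDER-ABC:A2.L-K (K-L6, IUTchII:Prop3.1(i)
instance of record) → rung 0 `Summit.ABC`.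
-/

noncomputable section

open Literature.AnabelianGeometry.EtaleTheta (ContH1 ThetaSetting)
open Literature.AnabelianGeometry.EtaleTheta
open _root_.Topology

namespace Literature.IUT.HodgeArakelov

namespace EtaleLevels

open CohomologySystemOfContH1 EtaleThetaDataOfSetting TemperedThetaMonoids BadPrimeGaussianMonoids
open Literature.AnabelianGeometry.EtaleTheta.SettingModel
open Literature.AnabelianGeometry.SemiGraphs

/-! ## The Tate instance, Galois factor `inr`, the `X̲̲` OF RECORD and the record's own data -/

section TateRecord

open ModelTateCarriers

variable (p : ℕ) [Fact p.Prime] (l : ℕ+) (hlo : Odd (l : ℕ)) (hlp : (l : ℕ).Prime) (hdvd : 4 * (l : ℕ) ∣ p - 1)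
  {Es : Set ℕ+} (τ : (ThetaSetting.modelTate p).CyclotomeTower l Es)

/-- **[IUTchII] Prop 3.1 (i) «splittings up to torsion» AT THE GENUINE `θ_env` RECORD OF THE TATE MODEL** (`modelTate p`, Galois
factor `inr`, class `η̈♯ = etaDdχq`, `X̲̲ := Huuχq` of record, root cocycle `rootLift`, cyclotome family `τ.modAll` of a tower `τ`,
EMPTY cusp labelling; `l` an odd prime with `4l ∣ p − 1`): `splitting_toRecord_padic_of_eval_modelχq` with, IN ADDITION, the
record's own inputs THEOREMS of the tree — `h15` (abc-iut-L2-t6 `prop15iii_etaleThetaDataOfClass_etaDdχq`), `h15ii` (abc-iut-L2-t8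
`prop13_prop15_sectionData_modelTate`), `hι` (abc-iut-L2-d1 `map_Huuχq_inversionχq`), `hf` (abc-iut-w5-d233 `rootLift_mem_rootCocycles`),
`hZ` (`ModelCyclotomes.nonempty_lDeltaQuot_rigidData_mulEquiv_zHat` under `IsEtThOrigin`/`hYcl`), `hlim` (abc-iut-w4-d030
`bijective_rigidLimHom`), `hp2`/`hpl`/`hζ` (abc-iut-w5-d233, from `4l ∣ p − 1`). RESIDUAL OF RECORD for NODES IUTchII:Prop3.1(i) at
the model of record: {(H1) `PiYddCharacteristic C` (F-2633 at the instance), the tower `τ` (DATA), the Cor 3.5 (K)/(E) DATA}.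
SEMI-SYNTHETIC MODEL, binder-discharge evidence only; no side taken on [IUTchIII] Cor. 3.12.
[claim: Mochizuki2012, status: disputed] (IUTchII §3 Prop 3.1 (i), kurims p.87) -/
theorem splitting_toRecord_padic_of_eval_modelTate :
    let hC := compat_modelχq p 1 2 even_two
    let hS := ThetaSetting.modelχq_sec2Hyps p 1 2 even_two
    let K₀ := (kummerCoreχq p 1 2 even_two).toKummerDataOfSection SemidirectProduct.inr (continuous_inrχq p 1 2)
        (fun _ => rfl) (map_inr_GK_le_GtpY_modelχq' p 1 2 even_two) (map_inr_GKdd_le_GtpYdd_modelχq' p 1 2 even_two)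
    let E := K₀.etaleThetaDataOfClass (etaDdχq p 1 2 even_two)
    let C := E.doubleUnderlineχqOfEtaRes p 1 2 l hlo (eta_res_etaDdχq p 1 2 even_two l hlo)
    let h15 : ThetaSetting.Prop15iii E hC :=
      prop15iii_etaleThetaDataOfClass_etaDdχq p hC SemidirectProduct.inr (continuous_inrχq p 1 2) (fun _ => rfl)
        (map_inr_GK_le_GtpY_modelχq' p 1 2 even_two) (map_inr_GKdd_le_GtpYdd_modelχq' p 1 2 even_two)
    let L : C.CuspLabels := ⟨fun _ => ∅, fun _ => ∅, fun _ => rfl⟩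
    let hO := ThetaSetting.modelχq_isEtThOrigin p 1 2 even_two
    let hYcl := hYcl_modelχq p 1 2 even_two
    let hp2 := ne_two_of_four_mul_dvd_pred p l.pos hdvd
    let hpl := ne_of_four_mul_dvd_pred p l.pos hdvd
    let hζ := exists_isPrimitiveRoot_K_modelχq p 1 2 even_two l.pos hdvd
    let hZ : ∀ M : ℕ+, Nonempty (ModelCyclotomes.lDeltaQuot (C.rigidData (τ.modAll M) hC hS h15 L) ≃*
        Literature.IUT.HodgeTheaters.ZHat) := fun M =>
      ModelCyclotomes.nonempty_lDeltaQuot_rigidData_mulEquiv_zHat C (τ.modAll M) hC hS h15 L hO hYcl hlp.ne_zero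
    let hlim := bijective_rigidLimHom C hC hS hlp hp2 hpl hζ τ.modAll (EtaleThetaDataOfSetting.rootLift C)
      (rootLift_mem_rootCocycles C hC) τ.red_modAll h15 L hZ
    let cι : ThetaSetting.ThetaCompanion (Dα := ThetaSetting.modelTate p) (Dβ := ThetaSetting.modelTate p) (inversionχq p 1 2) :=
      (ThetaSetting.modelTate p).thetaCompanionOfAut (inversionχq p 1 2)
        (isInversionAut_inversionχq p 1 2 even_two).map_deltaTemp (hasThetaTopology_modelχq p 1 2 even_two).isQuotientMap_toTheta
    haveI := piYdd_normal C hC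
    haveI : ((ThetaSetting.modelTate p).lDeltaTheta l).Normal := ThetaSetting.lDeltaTheta_normal _ l
    haveI : IsMulCommutative ((ThetaSetting.modelTate p).lDeltaTheta l) :=
      EtaleThetaDataOfSetting.instIsMulCommutative_lDeltaTheta (D := ThetaSetting.modelTate p) l
    letI : MulDistribMulAction (Pi C) (PadicAlgCl p)ˣ := EtaleThetaDataOfSetting.unitsAction C
    ∀ (hcharY : PiYddCharacteristic C),
    let R := thetaEnvData C hC hS hlp hp2 hpl hζ τ.modAll (EtaleThetaDataOfSetting.rootLift C) (rootLift_mem_rootCocycles C hC)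
      τ.red_modAll h15 L hZ hcharY hlim
    ∀ {Iota : Type} (iota : Iota → R.D.coh.lim ≃+ R.D.coh.lim)
      {P₀ : TopGroup.{0}} (φ₀ : P₀ →* (ThetaSetting.modelTate p).GtpTheta) (s₀ : P₀ →* Pi C)
      (hs₀ : Continuous ((MonoidHom.id (Pi C)).comp s₀))
      (hN : (⊤ : Subgroup P₀).map ((MonoidHom.id (Pi C)).comp s₀) ≤ PiYdd C)
      (hφ : (phi C).comp ((MonoidHom.id (Pi C)).comp s₀) = φ₀)
      [TopologicalSpace (PadicAlgCl p)ˣ]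
      (c : CyclotomeCoefficients (phi C) ((ThetaSetting.modelTate p).lDeltaTheta l) (PadicAlgCl p)ˣ)
      (hA : ∀ b : (PadicAlgCl p)ˣ, IsOpen (MulAction.stabilizer (Pi C) b : Set (Pi C)))
      (hfi : ∀ b : (PadicAlgCl p)ˣ, (MulAction.stabilizer (Pi C) b).FiniteIndex) (O : Submonoid (PadicAlgCl p)ˣ)
      [MulDistribMulAction P₀ (PadicAlgCl p)ˣ]
      (c₀ : CyclotomeCoefficients φ₀ ((ThetaSetting.modelTate p).lDeltaTheta l) (PadicAlgCl p)ˣ)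
      (hA₀ : ∀ b : (PadicAlgCl p)ˣ, IsOpen (MulAction.stabilizer P₀ b : Set P₀))
      (hfi₀ : ∀ b : (PadicAlgCl p)ˣ, (MulAction.stabilizer P₀ b).FiniteIndex)
      (_hc : Function.Bijective c.hom) (_hOtors : ∀ a : (PadicAlgCl p)ˣ, IsOfFinOrder a → a ∈ O ∧ a⁻¹ ∈ O)
      (_hc₀ : Function.Bijective c₀.hom) (_hc₀c : ∀ ζ, c₀.hom ζ = c.hom ζ)
      (_hact : ∀ (g : P₀) (a : (PadicAlgCl p)ˣ), g • a = s₀ g • a)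
      [((EtaleThetaDataOfSetting.aug C).comp s₀).range.FiniteIndex] {i₀ : Iota}
      (_hi₀ : iota i₀ = pairRhoLim C (inversionAlpha C (inversionχq p 1 2) (map_Huuχq_inversionχq p 1 2 l hlo)) cι.thetaIso
        (thetaCompanion_phi C (inversionχq p 1 2) (map_Huuχq_inversionχq p 1 2 l hlo) cι)
        (mem_lDeltaTheta_iff_thetaCompanion (D := ThetaSetting.modelTate p) (inversionχq p 1 2) cι l)
        (mem_PiYdd_iff_of_piYddCharacteristic C hcharY _))
      {θ : (R.toRecord (h1LimConjMulAut (phi C) ((ThetaSetting.modelTate p).lDeltaTheta l) (PiYdd C))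
        (h1LimKummerOn (phi C) ((ThetaSetting.modelTate p).lDeltaTheta l) (PiYdd C) c hA hfi O) iota).H}
      (_hθ : θ ∈ (R.toRecord (h1LimConjMulAut (phi C) ((ThetaSetting.modelTate p).lDeltaTheta l) (PiYdd C))
        (h1LimKummerOn (phi C) ((ThetaSetting.modelTate p).lDeltaTheta l) (PiYdd C) c hA hfi O) iota).thetaEnv i₀)
      (R₀ : (R.toRecord (h1LimConjMulAut (phi C) ((ThetaSetting.modelTate p).lDeltaTheta l) (PiYdd C))
          (h1LimKummerOn (phi C) ((ThetaSetting.modelTate p).lDeltaTheta l) (PiYdd C) c hA hfi O) iota).H →*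
        Multiplicative (h1Lim φ₀ ((ThetaSetting.modelTate p).lDeltaTheta l) (⊤ : Subgroup P₀) ⊥))
      (_hR₀ : ∀ y, Multiplicative.toAdd (R₀ y) =
        h1LimCongr ((ThetaSetting.modelTate p).lDeltaTheta l) ⊤ hφ ⊥
          (h1LimComap (phi C) ((ThetaSetting.modelTate p).lDeltaTheta l) ((MonoidHom.id (Pi C)).comp s₀) hs₀ hN
            (AddEquiv.additiveMultiplicative (h1Lim (phi C) ((ThetaSetting.modelTate p).lDeltaTheta l) (PiYdd C) ⊥)
              (Additive.ofMul y))))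
      (q : O) (_hRθ : R₀ θ = h1LimKummerOn φ₀ ((ThetaSetting.modelTate p).lDeltaTheta l) ⊤ c₀ hA₀ hfi₀ O q)
      (_hq : ¬ IsUnit q),
      IsSplittingUpToTorsion
          (R.toRecord (h1LimConjMulAut (phi C) ((ThetaSetting.modelTate p).lDeltaTheta l) (PiYdd C))
            (h1LimKummerOn (phi C) ((ThetaSetting.modelTate p).lDeltaTheta l) (PiYdd C) c hA hfi O) iota).units
          (Submonoid.closure ((R.toRecord (h1LimConjMulAut (phi C) ((ThetaSetting.modelTate p).lDeltaTheta l) (PiYdd C))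
            (h1LimKummerOn (phi C) ((ThetaSetting.modelTate p).lDeltaTheta l) (PiYdd C) c hA hfi O) iota).inftyThetaEnv i₀)) ∧
        IsSplittingUpToTorsion
          (R.toRecord (h1LimConjMulAut (phi C) ((ThetaSetting.modelTate p).lDeltaTheta l) (PiYdd C))
            (h1LimKummerOn (phi C) ((ThetaSetting.modelTate p).lDeltaTheta l) (PiYdd C) c hA hfi O) iota).units
          (Submonoid.closure ((R.toRecord (h1LimConjMulAut (phi C) ((ThetaSetting.modelTate p).lDeltaTheta l) (PiYdd C))
            (h1LimKummerOn (phi C) ((ThetaSetting.modelTate p).lDeltaTheta l) (PiYdd C) c hA hfi O) iota).thetaEnv i₀)) := by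
  intro hC hS K₀ E C h15 L hO hYcl hp2 hpl hζ hZ hlim cι hcharY R Iota iota P₀ φ₀ s₀ hs₀ hN hφ _ c hA hfi O _ c₀ hA₀ hfi₀ hc
    hOtors hc₀ hc₀c hact _ i₀ hi₀ θ hθ R₀ hR₀ q hRθ hq
  exact splitting_toRecord_padic_of_eval_modelχq p 1 2 even_two E C (map_Huuχq_inversionχq p 1 2 l hlo) hlp hp2 hpl hζ τ.modAll
    (EtaleThetaDataOfSetting.rootLift C) (rootLift_mem_rootCocycles C hC) τ.red_modAll h15 L hZ hcharY hlim rfl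
    (prop13_prop15_sectionData_modelTate p SemidirectProduct.inr (continuous_inrχq p 1 2) (fun _ => rfl)
      (map_inr_GK_le_GtpY_modelχq' p 1 2 even_two) (map_inr_GKdd_le_GtpYdd_modelχq' p 1 2 even_two) hC).2.2.1
    τ iota φ₀ s₀ hs₀ hN hφ c hA hfi O c₀ hA₀ hfi₀ hc hOtors hc₀ hc₀c hact hi₀ hθ R₀ hR₀ q hRθ hq

end TateRecord

/-! ### APPENDIX (gen 4, append-only): the base-point binder `θ ∈ θ^{i₀}_env(𝕄_*)` is NOT vacuous at the stage-2 model -/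

section Nonempty

open ModelTateCarriers

variable (p : ℕ) [Fact p.Prime] (i j : ℤ) (hj : Even j)
  (E : (ThetaSetting.modelχq p i j hj).EtaleThetaData) {l : ℕ} (C : E.DoubleUnderline l)
  (hι : C.Huu.map (inversionχq p i j).toMulEquiv.toMonoidHom = C.Huu)
  (hl : l.Prime) (hp2 : p ≠ 2) (hpl : p ≠ l) (hζ : ∃ ζ : (ThetaSetting.modelχq p i j hj).K, IsPrimitiveRoot ζ (4 * l))
  (mods : ∀ M : ℕ+, (ThetaSetting.modelχq p i j hj).CyclotomeMod l M)
  (f : contCocycles (ThetaSetting.modelχq p i j hj).toTheta (ThetaSetting.modelχq p i j hj).DeltaTheta C.GtpYdduu)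
  (hf : f ∈ C.rootCocycles (compat_modelχq p i j hj))
  (hmods : ∀ (M M' : ℕ+) (h : (M : ℕ) ∣ (M' : ℕ)) (x : (ThetaSetting.modelχq p i j hj).lDeltaTheta l),
    MuN.red p M M' h ((mods M').red x) = (mods M).red x)
  (h15 : ThetaSetting.Prop15iii E (compat_modelχq p i j hj))
  (L : C.CuspLabels)
  (hZ : ∀ M : ℕ+, Nonempty (ModelCyclotomes.lDeltaQuot (C.rigidData (mods M) (compat_modelχq p i j hj)
    (ThetaSetting.modelχq_sec2Hyps p i j hj) h15 L) ≃* Literature.IUT.HodgeTheaters.ZHat))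
  (hcharY : EtaleThetaDataOfSetting.PiYddCharacteristic C)
  (hlim : Function.Bijective (rigidLimHom C (compat_modelχq p i j hj) (ThetaSetting.modelχq_sec2Hyps p i j hj) hl hp2 hpl
    hζ mods f hf hmods h15 L hZ))

/-- **`θ^{i₀}_env(𝕄_*)` IS NONEMPTY at the `θ_env` record of the stage-2 model** for the inversion family through the limit action
of `ι := inversionχq` and ANY action / Kummer datum `(act, κ)` of the record: abc-iut-w4-d004's `thetaEnv_toRecord_nonempty_pairRhoLim`
(p441594) with the (R1) pair := `(inversionAlpha C ι hι, ι^Θ)`, the `ℤ`-reversal, the deck element, the `toLZ`-generator and (R2)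
`hsign`/`hroot` ALL DISCHARGED at the model (as in part 1; `hroot` in orbit form from abc-iut-L2-d1's `transport_etaDdχq`). So the
base-point binders `θ ∈ θ^{i₀}_env` of `splitting_toRecord_padic_of_eval_modelχq` / `…_modelTate` and of `horb_/hroots_toRecord_modelχq`
are inhabited at the model of record. [claim: Mochizuki2012, status: disputed] (IUTchII §3 Prop 3.1 (i), kurims p.87) -/
theorem thetaEnv_toRecord_nonempty_modelχq (hE : E.etaDd = etaDdχq p i j hj)
    (h15ii : ThetaSetting.Prop15ii E.toKummerData (compat_modelχq p i j hj)) :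
    let cι : ThetaSetting.ThetaCompanion (Dα := ThetaSetting.modelχq p i j hj) (Dβ := ThetaSetting.modelχq p i j hj)
        (inversionχq p i j) :=
      (ThetaSetting.modelχq p i j hj).thetaCompanionOfAut (inversionχq p i j)
        (isInversionAut_inversionχq p i j hj).map_deltaTemp (hasThetaTopology_modelχq p i j hj).isQuotientMap_toTheta
    let R := thetaEnvData C (compat_modelχq p i j hj) (ThetaSetting.modelχq_sec2Hyps p i j hj) hl hp2 hpl hζ mods f hf hmods
      h15 L hZ hcharY hlim
    haveI := piYdd_normal C (compat_modelχq p i j hj)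
    ∀ {Iota : Type} (iota : Iota → R.D.coh.lim ≃+ R.D.coh.lim) {M : Type} [CommMonoid M]
      (act : (modelSystem C (compat_modelχq p i j hj) (ThetaSetting.modelχq_sec2Hyps p i j hj) hl hp2 hpl hζ mods f hf hmods
        h15 L hZ).PiX →* MulAut (Multiplicative R.cohEnv.lim))
      (κ : M →* Multiplicative R.cohEnv.lim) {i₀ : Iota}
      (_hi₀ : iota i₀ = pairRhoLim C (inversionAlpha C (inversionχq p i j) hι) cι.thetaIso
        (thetaCompanion_phi C (inversionχq p i j) hι cι)
        (mem_lDeltaTheta_iff_thetaCompanion (D := ThetaSetting.modelχq p i j hj) (inversionχq p i j) cι l)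
        (mem_PiYdd_iff_of_piYddCharacteristic C hcharY _)),
      ((R.toRecord act κ iota).thetaEnv i₀).Nonempty := by
  intro cι R Iota iota M _ act κ i₀ hi₀
  haveI := piYdd_normal C (compat_modelχq p i j hj)
  haveI := (compat_modelχq p i j hj).GtpYdd_normal
  obtain ⟨γ, hγ⟩ := C.toLZ_surjective (Multiplicative.ofAdd 1)
  obtain ⟨ε, hε₁, hε₂⟩ := exists_deck_element C (ThetaSetting.modelχq_sec2Hyps p i j hj)
  have hZι : (ThetaSetting.modelχq p i j hj).toZ (inversionχq p i j (γ : (ThetaSetting.modelχq p i j hj).PiTemp)) =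
      ((ThetaSetting.modelχq p i j hj).toZ (γ : (ThetaSetting.modelχq p i j hj).PiTemp))⁻¹ :=
    (isInversionAut_inversionχq p i j hj).toZ_apply _
  obtain ⟨hsign, hroot, -⟩ := rootLevel_inputs_of_classLevel_orbit C (inversionχq p i j) hι cι
    (ThetaSetting.modelχq_sec2Hyps p i j hj) hcharY γ ε hγ hε₁ hε₂ 1
    (fun x => by
      rw [OneMemClass.coe_one, one_mul, inv_one, mul_one]
      exact inversionχq_inversionχq p i j _)
    (fun a ha => by
      rw [thetaIso_inversionχq_apply_eq_self p i j hj cι ha, mul_inv_cancel]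
      exact Subgroup.one_mem _)
    (h14sign_of_prop15iii C (compat_modelχq p i j hj) (ThetaSetting.modelχq_sec2Hyps p i j hj) h15 ε hε₁)
    (h14orbit_of_h14fix C (inversionχq p i j) hι cι hcharY
      (autMap_comap_etaDd_eq_self_modelχq p i j hj E hE C hι cι (mem_PiYdd_iff_of_piYddCharacteristic C hcharY _)))
    (h14free_of_prop15_of_origin C (compat_modelχq p i j hj) (ThetaSetting.modelχq_isEtThOrigin p i j hj) h15 h15ii γ hγ)
  exact thetaEnv_toRecord_nonempty_pairRhoLim C (compat_modelχq p i j hj) (ThetaSetting.modelχq_sec2Hyps p i j hj) hl hp2 hpl hζ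
    mods f hf hmods h15 L hZ hcharY hlim iota act κ (inversionAlpha C (inversionχq p i j) hι) cι.thetaIso
    (thetaCompanion_phi C (inversionχq p i j) hι cι)
    (mem_lDeltaTheta_iff_thetaCompanion (D := ThetaSetting.modelχq p i j hj) (inversionχq p i j) cι l)
    (mem_PiYdd_iff_of_piYddCharacteristic C hcharY _) γ ε hγ hε₁ hε₂
    (toLZ_inversionAlpha_generator C (inversionχq p i j) hι γ hγ hZι) hsign hroot hi₀

end Nonempty

end EtaleLevels

end Literature.IUT.HodgeArakelov

end
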